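import Summits.QuantumAdvantage.QuantumAdvantage.Theorems.NearExactIsExact.Negative.SkewProductResidual

/-!
# `NearExactIsExact` (stmt-QuantumAdvantage-14043) — negative lemma THEOREM OZ (gen 42), part 1/2:
  the fibre Taylor expansion at a moving base point and its three even-weight families

**Context.** THEOREM OZ (`Negative.OneSidedFrame`, part 2) empties the whole `A = 0` inversion-affine
stratum of the last Maiorana–McFarland habitat of `NearExactIsExact` (configurations
`π(u, w) = (γ u, B(u) ⊕ w)` over a 6-bit base: quadratic `γ` with a constant-derivative direction
`i₀`, quadratic `B`, cubic `c₁, c₂`, affine sections — cube Z, the E-cubes, THEOREM TT, the 26 column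
pencils; DISPROOF.md §46–§48 of the b2b cell) by the unconditional identity
`Σ_u c₂(γu,Bu) = Σ_a Σ_u (B_a(u) ⊕ B_a(u⁻))·(c₂(γu,Bu) ⊕ c₂(γu,Bu ⊕ e_a))` in `𝔽₂`, whose two sides the
residual identities force to be `1` and `0`.

**What this file proves (all `r`, pure tools, no residual hypothesis).**
* `sum_shannon`: `Σ_u φ(u) = Σ_u u_{i₀}·(φ(u⁺) + φ(u⁻))` over `𝔽₂` (`u^± = u|u_{i₀}←1/0`; the
  constant part `Σ_u φ(u⁻)` vanishes because every value is taken twice, `sum_update_false_eq_zero`).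
* `coefC_shift`: the `t`-Möbius coefficients (`coefC`, THEOREM A gen 17) of the fibre translate
  `p ↦ c(p ⊕ (0,s))` are the fibre derivatives `dsum c S` at `(v, s)` — so `expand` gives the Taylor
  expansion of a cubic around ANY fibre point: `c(x, s ⊕ β) = Σ_{|S|≤3} β_S·Δ_S c(x, s)`.
* `pointwise_taylor`: for cubic `c₂` and arbitrary `x⁺, x⁻, σ¹, σ⁰` (`β = σ¹ ⊕ σ⁰`),
  `c₂(x⁺,σ¹) + Σ_a β_a·D_a(x⁺,σ¹) + c₂(x⁻,σ⁰)`
  `= [c₂(x⁻,σ¹) + c₂(x⁺,σ¹)] + Σ_a β_a·[Δ_a c₂(x⁻,σ¹) + Δ_a c₂(x⁺,σ¹)] + Σ_{2≤|S|≤3} β_S·Δ_S c₂(x⁻,σ¹)`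
  (`D_a` = first fibre difference = `Δ_a = dsum c₂ {a}`, `dsum_singleton`; `sum_P3_split`).
* `family_zero`, `family_one`, `family_two`, `taylor_sum_zero`: with `P⁻ : 𝔽₂⁶ → 𝔽₂^{6+r}` of
  coordinate degree `≤ 2`, a CONSTANT direction `Δ`, affine `β_a`, the three families above, evaluated
  at `P⁻(u)` and `P⁻(u) ⊕ Δ` and multiplied by `u_{i₀}`, have degree `≤ 5, 4, 5` on 6 bits
  (`stub_derivDegree`, `dsum_deg`, `fc_isDegLeFun_comp`, `isDegLeFun_prod`), hence even weight
  (`sum_ind_eq_zero_of_deg_five`): their total `u`-sum is `0`.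

HONEST FRAMING: the value here is a THEOREM (kernel-checked expansion and parity tools for the negative
lemma THEOREM OZ on the last Maiorana–McFarland habitat of `NearExactIsExact`), NOT summit progress;
the crux and the summit are untouched.
-/

set_option linter.dupNamespace false -- D-0017: single-problem summit ⇒ `QuantumAdvantage.QuantumAdvantage` by design

namespace Summit.QuantumAdvantage.QuantumAdvantage.Theorems.NearExactIsExact.Negative.OneSidedTaylor

open Finset
open Literature.Computability.QuantumComplexity
open Literature.Computability.QuantumComplexity.BuzetChailloux (bxor)
open Summit.QuantumAdvantage.QuantumAdvantage.Theorems.CubicForrelation.NearExactIsExact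
  (fc_isDegLeFun_comp fc_deg_bxor stub_derivDegree te_isDegLeFun_band)
open Summit.QuantumAdvantage.QuantumAdvantage.Theorems.NearExactIsExact.Negative.SkewProductCore
open Summit.QuantumAdvantage.QuantumAdvantage.Theorems.NearExactIsExact.Negative.SkewProductResidual

variable {r : ℕ}

/-! ### Shannon split at one coordinate, over `𝔽₂` -/

/-- `y + (x + y) = x` in `𝔽₂`. [folklore] -/
theorem add_add_cancel : ∀ x y : ZMod 2, y + (x + y) = x := by decide

/-- Shannon split of an `𝔽₂`-valued function at the coordinate `i₀`. [folklore] -/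
theorem shannon_zmod (φ : (Fin 6 → Bool) → ZMod 2) (i₀ : Fin 6) (u : Fin 6 → Bool) :
    φ u = φ (Function.update u i₀ false) +
      ind (u i₀) * (φ (Function.update u i₀ true) + φ (Function.update u i₀ false)) := by
  cases h : u i₀
  · have e : Function.update u i₀ false = u := by rw [← h, Function.update_eq_self]
    rw [e, ind_false, zero_mul, add_zero]
  · have e : Function.update u i₀ true = u := by rw [← h, Function.update_eq_self]
    rw [e, ind_true, one_mul, add_add_cancel]

/-- `Σ_u φ(u|u_{i₀}←0) = 0` in `𝔽₂`: every value is taken twice. [folklore] -/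
theorem sum_update_false_eq_zero (φ : (Fin 6 → Bool) → ZMod 2) (i₀ : Fin 6) :
    ∑ u : Fin 6 → Bool, φ (Function.update u i₀ false) = 0 :=
  sum_ninvolution (fun u => Function.update u i₀ (!u i₀))
    (fun u => by rw [Function.update_idem, CharTwo.add_self_eq_zero])
    (fun u _ h => by
      have h' := congr_fun h i₀
      rw [Function.update_self] at h'
      exact Bool.not_ne_self _ h')
    (fun u => mem_univ _)
    (fun u => by
      rw [Function.update_idem, Function.update_self, Bool.not_not, Function.update_eq_self])

/-- `Σ_u φ(u) = Σ_u u_{i₀}·(φ(u⁺) + φ(u⁻))`. [folklore] -/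
theorem sum_shannon (φ : (Fin 6 → Bool) → ZMod 2) (i₀ : Fin 6) :
    ∑ u : Fin 6 → Bool, φ u = ∑ u : Fin 6 → Bool, ind (u i₀) *
      (φ (Function.update u i₀ true) + φ (Function.update u i₀ false)) := by
  rw [sum_congr rfl (fun u (_ : u ∈ (univ : Finset (Fin 6 → Bool))) => shannon_zmod φ i₀ u),
    sum_add_distrib, sum_update_false_eq_zero, zero_add]

/-! ### Affine bookkeeping: updates, flips, fibre translates -/

/-- The coordinates of `u ↦ u|u_{i₀}←b` are affine. [folklore] -/
theorem update_coord_deg (i₀ : Fin 6) (b : Bool) :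
    ∀ j, IsDegLeFun 1 (fun u : Fin 6 → Bool => Function.update u i₀ b j) := by
  intro j
  by_cases hj : j = i₀
  · subst hj
    have e : (fun u : Fin 6 → Bool => Function.update u j b j) = fun _ => b :=
      funext fun u => Function.update_self j b u
    rw [e]; exact isDegLeFun_const 1 b
  · have e : (fun u : Fin 6 → Bool => Function.update u i₀ b j) = fun u => u j :=
      funext fun u => Function.update_of_ne hj b u
    rw [e]; exact isDegLeFun_apply j le_rfl

/-- `u⁺ ⊕ e_{i₀} = u⁻`. [folklore] -/
theorem update_true_bxor (u : Fin 6 → Bool) (i₀ : Fin 6) :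
    bxor (Function.update u i₀ true) (fun i => decide (i = i₀)) = Function.update u i₀ false := by
  funext i
  by_cases hi : i = i₀
  · subst hi; simp [bxor]
  · simp [bxor, hi]

/-- `(x, σ) ⊕ e_{6+a} = (x, σ ⊕ e_a)`. [folklore] -/
theorem append_bxor_dir (x : Fin 6 → Bool) (σ : Fin r → Bool) (a : Fin r) :
    bxor (Fin.append x σ) (dir a) = Fin.append x (fun k => decide (k = a) ^^ σ k) := by
  funext j
  induction j using Fin.addCases with
  | left i => simp [bxor, dir]
  | right k => simp [bxor, dir, Bool.xor_comm]

/-- `⊕` acts blockwise on `𝔽₂⁶ × 𝔽₂^r`. [folklore] -/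
theorem bxor_append_blocks (a c : Fin 6 → Bool) (b d : Fin r → Bool) :
    bxor (Fin.append a b) (Fin.append c d) = Fin.append (bxor a c) (bxor b d) := by
  funext j
  induction j using Fin.addCases with
  | left i => simp only [bxor, Fin.append_left]
  | right k => simp only [bxor, Fin.append_right]

/-- `s ⊕ 0 = s`. [folklore] -/
theorem bxor_zero_right {n : ℕ} (s : Fin n → Bool) : bxor s (fun _ => false) = s := by
  funext j; simp [bxor]

/-- The fibre translate `p ↦ c(p ⊕ (0,s))` of a cubic is cubic. [folklore] -/
theorem shift_deg (c : (Fin (6 + r) → Bool) → Bool) (hc : IsDegLeFun 3 c) (s : Fin r → Bool) :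
    IsDegLeFun 3 (fun p : Fin (6 + r) → Bool => c (bxor p (Fin.append (fun _ : Fin 6 => false) s))) :=
  fc_isDegLeFun_comp hc (fun p => bxor p (Fin.append (fun _ : Fin 6 => false) s))
    (fun j => fc_deg_bxor (isDegLeFun_apply j le_rfl) (isDegLeFun_const 1 _)) (by norm_num)

/-- The Möbius coefficients of the translate are the fibre derivatives at `(v, s)`:
`coefC (c(· ⊕ (0,s))) S v = dsum c S (v, s)`. [folklore] -/
theorem coefC_shift (c : (Fin (6 + r) → Bool) → Bool) (s : Fin r → Bool) (S : Finset (Fin r))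
    (v : Fin 6 → Bool) :
    coefC (fun p => c (bxor p (Fin.append (fun _ : Fin 6 => false) s))) S v =
      dsum c S (Fin.append v s) := by
  have hv : ∀ J : Finset (Fin r), bxor (bxor (emb r v) (L J)) (Fin.append (fun _ : Fin 6 => false) s) =
      bxor (Fin.append v s) (L J) := by
    intro J; funext j
    induction j using Fin.addCases with
    | left i => simp [bxor, emb, L]
    | right k => simp [bxor, emb, L, Bool.xor_comm]
  simp only [coefC, dsum, hv]

/-- `dsum c ∅ = c`. [folklore] -/
theorem dsum_empty (c : (Fin (6 + r) → Bool) → Bool) : dsum c ∅ = c := by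
  funext x; simp only [dsum, powerset_empty, sum_singleton, bxor_L_empty, decide_ind_eq_one]

/-- `dsum c {a} p = c(p) ⊕ c(p ⊕ e_{6+a})`. [folklore] -/
theorem dsum_singleton (c : (Fin (6 + r) → Bool) → Bool) (a : Fin r) (p : Fin (6 + r) → Bool) :
    dsum c {a} p = (c p ^^ c (bxor p (dir a))) := by
  rw [← insert_empty, dsum_insert c (notMem_empty a), dsum_empty]

/-- `Σ_{|S| ≤ 3} F S = F ∅ + Σ_a F {a} + Σ_{2 ≤ |S| ≤ 3} F S`. [folklore] -/
theorem sum_P3_split (F : Finset (Fin r) → ZMod 2) :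
    ∑ S ∈ P3 r, F S = F ∅ + ∑ a, F {a} + ∑ S ∈ (P3 r).filter (fun S => 2 ≤ S.card), F S := by
  rw [← sum_filter_add_sum_filter_not (P3 r) (fun S => 2 ≤ S.card) F]
  have hset : (P3 r).filter (fun S => ¬ 2 ≤ S.card) =
      (univ : Finset (Fin r)).powersetCard 0 ∪ (univ : Finset (Fin r)).powersetCard 1 := by
    ext S
    simp only [mem_filter, mem_P3, mem_union, mem_powersetCard, subset_univ, true_and]
    omega
  have hdisj : Disjoint ((univ : Finset (Fin r)).powersetCard 0) ((univ : Finset (Fin r)).powersetCard 1) :=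
    disjoint_left.mpr fun S h0 h1 => by
      have e0 := (mem_powersetCard.mp h0).2
      have e1 := (mem_powersetCard.mp h1).2
      omega
  rw [hset, sum_union hdisj, powersetCard_zero, sum_singleton, powersetCard_one, sum_map]
  simp only [Function.Embedding.coeFn_mk]
  ring

/-! ### The pointwise Taylor identity -/

/-- For cubic `c₂` and arbitrary `x⁺, x⁻ ∈ 𝔽₂⁶`, `σ¹, σ⁰ ∈ 𝔽₂^r` (think `β = σ¹ ⊕ σ⁰`):
`c₂(x⁺,σ¹) + Σ_a β_a·(c₂(x⁺,σ¹) ⊕ c₂(x⁺,σ¹⊕e_a)) + c₂(x⁻,σ⁰)`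
`= [c₂(x⁻,σ¹) + c₂(x⁺,σ¹)] + Σ_a β_a·[Δ_a c₂(x⁻,σ¹) + Δ_a c₂(x⁺,σ¹)] + Σ_{2≤|S|≤3} β_S·Δ_S c₂(x⁻,σ¹)`
— the fibre Taylor expansion of `c₂(x⁻, σ¹ ⊕ β)` around `σ¹`, regrouped. [folklore] -/
theorem pointwise_taylor (c₂ : (Fin (6 + r) → Bool) → Bool) (h₂ : IsDegLeFun 3 c₂)
    (xp xm : Fin 6 → Bool) (σ1 σ0 : Fin r → Bool) :
    ind (c₂ (Fin.append xp σ1)) +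
        ∑ a, ind ((σ1 a ^^ σ0 a) &&
          (c₂ (Fin.append xp σ1) ^^ c₂ (Fin.append xp (fun k => decide (k = a) ^^ σ1 k)))) +
        ind (c₂ (Fin.append xm σ0)) =
      (ind (c₂ (Fin.append xm σ1)) + ind (c₂ (Fin.append xp σ1))) +
        ∑ a, ind (σ1 a ^^ σ0 a) *
          (ind (dsum c₂ {a} (Fin.append xm σ1)) + ind (dsum c₂ {a} (Fin.append xp σ1))) +
        ∑ S ∈ (P3 r).filter (fun S => 2 ≤ S.card),
          (∏ j ∈ S, ind (σ1 j ^^ σ0 j)) * ind (dsum c₂ S (Fin.append xm σ1)) := by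
  -- the section derivatives at `(x⁺, σ¹)` are first fibre derivatives
  have E2 : ∀ a, ind ((σ1 a ^^ σ0 a) &&
      (c₂ (Fin.append xp σ1) ^^ c₂ (Fin.append xp (fun k => decide (k = a) ^^ σ1 k)))) =
      ind (σ1 a ^^ σ0 a) * ind (dsum c₂ {a} (Fin.append xp σ1)) := fun a => by
    rw [ind_and, dsum_singleton, append_bxor_dir]
  -- Taylor expansion of `c₂(x⁻, σ⁰) = c₂^{σ¹}(x⁻, β)` by `expand` applied to the translate
  have hv : bxor (Fin.append xm (fun j => σ1 j ^^ σ0 j)) (Fin.append (fun _ : Fin 6 => false) σ1) =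
      Fin.append xm σ0 := by
    rw [bxor_append_blocks, bxor_zero_right]
    congr 1
    funext j
    show ((σ1 j ^^ σ0 j) ^^ σ1 j) = σ0 j
    cases σ1 j <;> cases σ0 j <;> rfl
  have E3 : ind (c₂ (Fin.append xm σ0)) =
      ∑ S ∈ P3 r, (∏ j ∈ S, ind (σ1 j ^^ σ0 j)) * ind (dsum c₂ S (Fin.append xm σ1)) := by
    have hx : ind (c₂ (bxor (Fin.append xm (fun j => σ1 j ^^ σ0 j))
        (Fin.append (fun _ : Fin 6 => false) σ1))) =
        texp (coefC (fun p => c₂ (bxor p (Fin.append (fun _ : Fin 6 => false) σ1))))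
          (fun j => σ1 j ^^ σ0 j) xm :=
      expand (fun p => c₂ (bxor p (Fin.append (fun _ : Fin 6 => false) σ1))) (shift_deg c₂ h₂ σ1)
        xm (fun j => σ1 j ^^ σ0 j)
    rw [hv] at hx
    rw [hx]
    simp only [texp]
    exact sum_congr rfl fun S _ => by rw [coefC_shift]
  rw [sum_congr rfl (fun a _ => E2 a), E3, sum_P3_split, prod_empty, one_mul, dsum_empty]
  simp only [prod_singleton, mul_add, sum_add_distrib]
  ring

/-! ### The three vanishing families -/

/-- Family `S = ∅`: `Σ_u u_{i₀}·(c₂(P⁻u) + c₂(P⁻u ⊕ Δ)) = 0` — the derivative of a cubic along the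
constant direction `Δ` is quadratic, its pullback along the quadratic `P⁻` has degree `≤ 4`. [folklore] -/
theorem family_zero (c₂ : (Fin (6 + r) → Bool) → Bool) (h₂ : IsDegLeFun 3 c₂) (i₀ : Fin 6)
    (Δ : Fin (6 + r) → Bool) (Pm : (Fin 6 → Bool) → (Fin (6 + r) → Bool))
    (hPm : ∀ j, IsDegLeFun 2 (fun u => Pm u j)) :
    ∑ u : Fin 6 → Bool, ind (u i₀) * (ind (c₂ (Pm u)) + ind (c₂ (bxor (Pm u) Δ))) = 0 := by
  have e : ∀ u : Fin 6 → Bool, ind (u i₀ && (c₂ (Pm u) ^^ c₂ (bxor (Pm u) Δ))) =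
      ind (u i₀) * (ind (c₂ (Pm u)) + ind (c₂ (bxor (Pm u) Δ))) := fun u => by
    rw [ind_and, ind_xor]
  rw [← sum_congr rfl (fun u _ => e u)]
  have hD : IsDegLeFun 2 (fun p => c₂ p ^^ c₂ (bxor p Δ)) := stub_derivDegree (6 + r) 2 c₂ Δ h₂
  have h4 : IsDegLeFun 4 (fun u => c₂ (Pm u) ^^ c₂ (bxor (Pm u) Δ)) :=
    fc_isDegLeFun_comp hD Pm hPm (by norm_num)
  exact sum_ind_eq_zero_of_deg_five ((te_isDegLeFun_band (isDegLeFun_apply i₀ le_rfl) h4).mono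
    (by norm_num))

/-- Family `|S| = 1`: `Σ_u u_{i₀}·β_a(u)·(Δ_a c₂(P⁻u) + Δ_a c₂(P⁻u ⊕ Δ)) = 0` for affine `β_a`
(degree `1 + 1 + 2·1 = 4`). [folklore] -/
theorem family_one (c₂ : (Fin (6 + r) → Bool) → Bool) (h₂ : IsDegLeFun 3 c₂) (i₀ : Fin 6)
    (Δ : Fin (6 + r) → Bool) (Pm : (Fin 6 → Bool) → (Fin (6 + r) → Bool))
    (hPm : ∀ j, IsDegLeFun 2 (fun u => Pm u j)) (β : Fin r → (Fin 6 → Bool) → Bool)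
    (hβ : ∀ a, IsDegLeFun 1 (β a)) (a : Fin r) :
    ∑ u : Fin 6 → Bool, ind (u i₀) * (ind (β a u) *
      (ind (dsum c₂ {a} (Pm u)) + ind (dsum c₂ {a} (bxor (Pm u) Δ)))) = 0 := by
  have e : ∀ u : Fin 6 → Bool,
      ind (u i₀ && (β a u && (dsum c₂ {a} (Pm u) ^^ dsum c₂ {a} (bxor (Pm u) Δ)))) =
      ind (u i₀) * (ind (β a u) *
        (ind (dsum c₂ {a} (Pm u)) + ind (dsum c₂ {a} (bxor (Pm u) Δ)))) := fun u => by
    rw [ind_and, ind_and, ind_xor]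
  rw [← sum_congr rfl (fun u _ => e u)]
  have hd2 : IsDegLeFun 2 (dsum c₂ {a}) := by
    have h := dsum_deg c₂ h₂ {a}
    rw [card_singleton] at h
    exact h
  have hD : IsDegLeFun 1 (fun p => dsum c₂ {a} p ^^ dsum c₂ {a} (bxor p Δ)) :=
    stub_derivDegree (6 + r) 1 (dsum c₂ {a}) Δ hd2
  have hc : IsDegLeFun 2 (fun u => dsum c₂ {a} (Pm u) ^^ dsum c₂ {a} (bxor (Pm u) Δ)) :=
    fc_isDegLeFun_comp hD Pm hPm (by norm_num)
  exact sum_ind_eq_zero_of_deg_five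
    ((te_isDegLeFun_band (isDegLeFun_apply i₀ le_rfl) (te_isDegLeFun_band (hβ a) hc)).mono
      (by norm_num))

/-- Family `2 ≤ |S| ≤ 3`: `Σ_u u_{i₀}·β_S(u)·Δ_S c₂(P⁻u) = 0`
(degree `1 + |S| + 2(3 − |S|) = 7 − |S| ≤ 5`). [folklore] -/
theorem family_two (c₂ : (Fin (6 + r) → Bool) → Bool) (h₂ : IsDegLeFun 3 c₂) (i₀ : Fin 6)
    (Pm : (Fin 6 → Bool) → (Fin (6 + r) → Bool)) (hPm : ∀ j, IsDegLeFun 2 (fun u => Pm u j))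
    (β : Fin r → (Fin 6 → Bool) → Bool) (hβ : ∀ a, IsDegLeFun 1 (β a))
    (S : Finset (Fin r)) (hS2 : 2 ≤ S.card) (hS3 : S.card ≤ 3) :
    ∑ u : Fin 6 → Bool, ind (u i₀) * ((∏ j ∈ S, ind (β j u)) * ind (dsum c₂ S (Pm u))) = 0 := by
  have e : ∀ u : Fin 6 → Bool,
      ind (u i₀ && (decide ((∏ j ∈ S, ind (β j u)) = 1) && dsum c₂ S (Pm u))) =
      ind (u i₀) * ((∏ j ∈ S, ind (β j u)) * ind (dsum c₂ S (Pm u))) := fun u => by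
    rw [ind_and, ind_and, ind_decide_eq_one]
  rw [← sum_congr rfl (fun u _ => e u)]
  have hp : IsDegLeFun (1 * S.card) (fun u => decide ((∏ j ∈ S, ind (β j u)) = 1)) :=
    isDegLeFun_prod β S (fun j _ => hβ j)
  have hc : IsDegLeFun (2 * (3 - S.card)) (fun u => dsum c₂ S (Pm u)) :=
    fc_isDegLeFun_comp (dsum_deg c₂ h₂ S) Pm hPm le_rfl
  exact sum_ind_eq_zero_of_deg_five
    ((te_isDegLeFun_band (isDegLeFun_apply i₀ le_rfl) (te_isDegLeFun_band hp hc)).mono (by omega))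

/-- The three families together: for cubic `c₂`, a constant direction `Δ`, a base point map `P⁻` with
quadratic coordinates and affine `β_a`,
`Σ_u u_{i₀}·( [c₂(P⁻) + c₂(P⁻⊕Δ)] + Σ_a β_a[Δ_a c₂(P⁻) + Δ_a c₂(P⁻⊕Δ)] + Σ_{2≤|S|≤3} β_S Δ_S c₂(P⁻) ) = 0`.
[folklore] -/
theorem taylor_sum_zero (c₂ : (Fin (6 + r) → Bool) → Bool) (h₂ : IsDegLeFun 3 c₂) (i₀ : Fin 6)
    (Δ : Fin (6 + r) → Bool) (Pm : (Fin 6 → Bool) → (Fin (6 + r) → Bool))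
    (hPm : ∀ j, IsDegLeFun 2 (fun u => Pm u j)) (β : Fin r → (Fin 6 → Bool) → Bool)
    (hβ : ∀ a, IsDegLeFun 1 (β a)) :
    ∑ u : Fin 6 → Bool, ind (u i₀) *
      ((ind (c₂ (Pm u)) + ind (c₂ (bxor (Pm u) Δ))) +
        ∑ a, ind (β a u) * (ind (dsum c₂ {a} (Pm u)) + ind (dsum c₂ {a} (bxor (Pm u) Δ))) +
        ∑ S ∈ (P3 r).filter (fun S => 2 ≤ S.card),
          (∏ j ∈ S, ind (β j u)) * ind (dsum c₂ S (Pm u))) = 0 := by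
  have e : ∀ u : Fin 6 → Bool, ind (u i₀) *
      ((ind (c₂ (Pm u)) + ind (c₂ (bxor (Pm u) Δ))) +
        ∑ a, ind (β a u) * (ind (dsum c₂ {a} (Pm u)) + ind (dsum c₂ {a} (bxor (Pm u) Δ))) +
        ∑ S ∈ (P3 r).filter (fun S => 2 ≤ S.card),
          (∏ j ∈ S, ind (β j u)) * ind (dsum c₂ S (Pm u))) =
      ind (u i₀) * (ind (c₂ (Pm u)) + ind (c₂ (bxor (Pm u) Δ))) +
        ∑ a, ind (u i₀) * (ind (β a u) *
          (ind (dsum c₂ {a} (Pm u)) + ind (dsum c₂ {a} (bxor (Pm u) Δ)))) +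
        ∑ S ∈ (P3 r).filter (fun S => 2 ≤ S.card),
          ind (u i₀) * ((∏ j ∈ S, ind (β j u)) * ind (dsum c₂ S (Pm u))) := fun u => by
    rw [mul_add, mul_add, mul_sum, mul_sum]
  have hT1 : ∑ u : Fin 6 → Bool, ∑ a, ind (u i₀) * (ind (β a u) *
      (ind (dsum c₂ {a} (Pm u)) + ind (dsum c₂ {a} (bxor (Pm u) Δ)))) = 0 := by
    rw [sum_comm]
    exact sum_eq_zero fun a _ => family_one c₂ h₂ i₀ Δ Pm hPm β hβ a
  have hT2 : ∑ u : Fin 6 → Bool, ∑ S ∈ (P3 r).filter (fun S => 2 ≤ S.card),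
      ind (u i₀) * ((∏ j ∈ S, ind (β j u)) * ind (dsum c₂ S (Pm u))) = 0 := by
    rw [sum_comm]
    exact sum_eq_zero fun S hS =>
      family_two c₂ h₂ i₀ Pm hPm β hβ S (mem_filter.mp hS).2 (mem_P3.mp (mem_filter.mp hS).1)
  rw [sum_congr rfl (fun u _ => e u), sum_add_distrib, sum_add_distrib,
    family_zero c₂ h₂ i₀ Δ Pm hPm, hT1, hT2, add_zero, add_zero]

end Summit.QuantumAdvantage.QuantumAdvantage.Theorems.NearExactIsExact.Negative.OneSidedTaylor
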